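import Mathlib.MeasureTheory.Integral.Prod
import Literature.Analysis.FunctionSpaces.ItoMartingale
import Literature.Analysis.FunctionSpaces.ItoProcessesLipschitz
import Literature.Probability.Process.ItoIntegralLinearity
import Literature.Analysis.FunctionSpaces.SquaredBessel
import Literature.Analysis.FunctionSpaces.YamadaWatanabeOccupation
import HarnessLib

/-!
# Yamada–Watanabe pathwise uniqueness (Revuz–Yor IX (3.5)(ii)): the proof

Sibling proof file of `Literature/Analysis/FunctionSpaces/SquaredBessel.lean`. It discharges the
named fact `Literature.Analysis.FunctionSpaces.pathwiseUnique_strongSolution_of_sq_sub_le`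
(Revuz–Yor, Ch. IX, Thm (3.5)(ii); Yamada–Watanabe 1971, Thm 1): on the canonical space
`(ℝ≥0 → ℝ, preWienerMeasure)` with the canonical Brownian motion `B = brownian` and its raw
natural filtration `𝓕 = brownianFiltration`, two solutions `X, X'` adapted to `𝓕` of
`dX = b(t, X) dt + σ(t, X) dB`, `X₀ = X'₀ = x₀`, are indistinguishable as soon as `b, σ` are
jointly Borel, `σ` is locally bounded, `(σ(s,x) - σ(s,y))² ≤ ρ(|x - y|)` for a Borel `ρ > 0` on
`(0, ∞)` with `∫_{0+} da/ρ(a) = +∞`, and `b` is Lipschitz in `x` on compacts locally uniformly in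
time.

## The proof

Revuz–Yor prove (3.5)(ii) through local times (Le Gall's argument: Lemma (3.3), Cor. (3.4),
Tanaka's formula), which the tree does not have. We use the original expectation argument of
Yamada–Watanabe (Itô's formula for even `C²` test functions `Φ` of the difference, `|Φ'| ≤ 1`,
`Φ(x) ≥ |x| - δ`, then Gronwall), organised exactly as the uniqueness half of Itô's theorem for
Lipschitz coefficients in `ItoProcessesProofs.lean` (`IsStrongSolution.stopped_ae_eq`,
`IsStrongSolution.unique_of_isStronglyProgressive`, `IsStrongSolution.unique_of_lipschitz`):

* reduce to progressively measurable solutions (`IsStrongSolution.dyadicReg_spec`);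
* localise at the optional times `τ_k = ratHitting (|X| ∨ |Y|) (|x₀| + k)` of the raw filtration:
  the stopped difference `D = Y^τ - X^τ` is the Itô process
  `∫₀ 𝟙_{[0,τ]}(b(Y) - b(X)) ds + (N₂ - N₁)`, where `Nᵢ` are progressive versions of the
  square-integrable (martingale) Itô integrals of the truncated coefficients `𝟙_{[0,τ]} σ(Xᵢ)`
  (`exists_itoIntegral_truncation_of_sq_integrable_holds`, `exists_isItoIntegral_of_sq_integrable`,
  `IsItoIntegral.unique_holds`, linearity `IsItoIntegral.sub_of_martingale`); its drift `β` and
  diffusion coefficient `γ` satisfy `|β| ≤ K|D|` on `[0, T]` and `γ² ≤ ρ(|D|) 𝟙_{D ≠ 0}` almost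
  surely (local Lipschitz bound of `b`, the Hölder-type bound of `σ`, `|X|, |Y| ≤ L` on `[0, τ]`);
* **the Yamada–Watanabe estimate** (`ae_eq_zero_of_yamadaWatanabe`): for such an Itô process,
  Itô's formula (`ito_formula_itoProcess_ae_holds`) for `Φ(D)` with the martingale Itô integral
  `∫ γ Φ'(D) dB` (`exists_isItoIntegral_of_sq_integrable`, so that its expectation vanishes) gives
  `E|D_t| - δ ≤ E Φ(D_t) ≤ K ∫₀ᵗ E|D_s| ds + ½ E ∫₀ᵀ γ² Φ''(D) ds`.
  The last term is `½ ∫ Φ'' dν` for the finite Borel measure `ν = |D|_* (γ² · ds ⊗ dW)` on `ℝ`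
  (expected occupation measure of `|D|` on `[0, T]` weighted by `d⟨D⟩`), which satisfies
  `∫_{(0,∞)} ρ⁻¹ dν ≤ T` because `γ² ≤ ρ(|D|)`. For a merely Borel `ρ` one cannot choose `Φ''`
  with `Φ'' ρ ≤ 2/n` pointwise; instead `Φ'' = p ∘ |·|` is chosen *adapted to `ν`*
  (`exists_testDensity` of `YamadaWatanabeOccupation.lean`: `p ≥ 0` continuous, supported in
  `(0, δ)`, `∫ p = 1`, `∫ p dν ≤ ε`), which makes the last term `≤ ε/2`; letting `δ, ε → 0` and
  applying Gronwall's lemma (`eq_zero_of_le_integral`) gives `E|D_t| = 0` on `[0, T]`;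
* let `k → ∞` along the a.s. continuous paths and use the density of rational times.

## References

* D. Revuz, M. Yor, *Continuous Martingales and Brownian Motion* (3rd ed., 1999), Ch. IX, §3:
  standing assumptions (p. 348 of the PDF: "σ locally bounded", "ρ Borel from `]0,∞[` into itself
  with `∫_{0+} da/ρ(a) = +∞`"), Lemma (3.3), Cor. (3.4), Thm (3.5)(ii) (p. 350); Ch. IV,
  Thm (3.3) (Itô's formula); Appendix §1 (Gronwall's lemma).
* T. Yamada, S. Watanabe, *On the uniqueness of solutions of stochastic differential equations*,
  J. Math. Kyoto Univ. 11 (1971), 155–167, Thm 1.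
-/

noncomputable section

open MeasureTheory Filter Set
open scoped NNReal ENNReal Topology

namespace Literature.Analysis.FunctionSpaces

open Literature.Probability.Process Literature.Probability.RandomPlanarGeometry

/-! ### Square integrability of truncated, locally bounded coefficients -/

/-- If `σ` is locally bounded on `ℝ₊ × ℝ` and `|X| ≤ L` on `[0, τ]` almost surely, then the
truncated coefficient `𝟙_{[0,τ]} σ(·, X)` satisfies `E ∫₀ᵗ (𝟙_{[0,τ]} σ(s, X_s))² ds < ∞` for every
`t` (it is a.s. bounded on `[0, t]` by the bound of `σ` on `[0, t] × [-L, L]`). This is the use of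
the standing assumption "`σ` locally bounded" in the proof of Revuz–Yor IX (3.5)(ii) ("`σ(s, Y_s^i)`
is bounded" after stopping).
Revuz–Yor, *Continuous Martingales and Brownian Motion* (1999), Ch. IX, §3 (p. 348) and proof of
Thm (3.5)(ii). [cite: RevuzYor1999, Ch. IX Thm (3.5)(ii)] -/
theorem lintegral_trunc_along_sq_ne_top_of_locally_bounded {σ : ℝ → ℝ → ℝ}
    (hσbd : ∀ t R : ℝ, ∃ C : ℝ, ∀ s ∈ Set.Icc 0 t, ∀ x ∈ Set.Icc (-R) R, |σ s x| ≤ C)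
    {X : ℝ≥0 → (ℝ≥0 → ℝ) → ℝ} {τ : (ℝ≥0 → ℝ) → WithTop ℝ≥0} {L : ℝ}
    (hbound : ∀ᵐ ω ∂preWienerMeasure, ∀ s : ℝ≥0, (s : WithTop ℝ≥0) ≤ τ ω → |X s ω| ≤ L)
    (t : ℝ≥0) :
    ∫⁻ ω, (∫⁻ s in Set.Icc (0 : ℝ) t,
      ENNReal.ofReal (trunc τ (along σ X) s.toNNReal ω ^ 2)) ∂preWienerMeasure ≠ ∞ := by
  obtain ⟨C, hC⟩ := hσbd t L
  have hpt : ∀ᵐ ω ∂preWienerMeasure, ∫⁻ s in Set.Icc (0 : ℝ) t,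
      ENNReal.ofReal (trunc τ (along σ X) s.toNNReal ω ^ 2) ≤
      ENNReal.ofReal (C ^ 2) * volume (Set.Icc (0 : ℝ) t) := by
    filter_upwards [hbound] with ω hω
    rw [← setLIntegral_const]
    refine setLIntegral_mono' measurableSet_Icc fun s hs ↦ ENNReal.ofReal_le_ofReal ?_
    rw [trunc_apply]
    split_ifs with h
    · have hsT : ((s.toNNReal : ℝ≥0) : ℝ) ∈ Set.Icc 0 (t : ℝ) :=
        ⟨NNReal.coe_nonneg _, by rw [Real.coe_toNNReal _ hs.1]; exact hs.2⟩
      have hx : X s.toNNReal ω ∈ Set.Icc (-L) L := abs_le.1 (hω _ h)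
      have h3 : |along σ X s.toNNReal ω| ≤ C := hC _ hsT _ hx
      rw [← sq_abs]
      exact pow_le_pow_left₀ (abs_nonneg _) h3 2
    · simp only [ne_eq, OfNat.ofNat_ne_zero, not_false_eq_true, zero_pow]
      positivity
  refine (lt_of_le_of_lt (lintegral_mono_ae hpt) ?_).ne
  rw [lintegral_const]
  exact ENNReal.mul_lt_top (ENNReal.mul_lt_top ENNReal.ofReal_lt_top measure_Icc_lt_top)
    (measure_lt_top _ _)

/-! ### The Yamada–Watanabe estimate for an Itô process -/

/-- **The Yamada–Watanabe estimate.** Let `D = ∫₀ β ds + ∫₀ γ dB` be a progressively measurable Itô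
process driven by the canonical Brownian motion (raw filtration), with `D₀ = 0`, a.s. bounded
paths (`|D| ≤ M`), progressive `β, γ`, `E ∫₀ᵗ γ² ds < ∞` for all `t`, and, almost surely,
`|β_s| ≤ K |D_s|` for `s ≤ T`, `γ_s² ≤ ρ(|D_s|)` when `D_s ≠ 0` and `γ_s = 0` when `D_s = 0`, where
`ρ > 0` is Borel on `(0, ∞)` with `∫_{0+} da/ρ(a) = +∞`. Then `D_s = 0` a.s. for every `s ≤ T`.
Proof: for `t ≤ T` and a test function `Φ = ywFun p` (`|Φ'| ≤ 1`, `|x| - δ ≤ Φ(x) ≤ |x|`,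
`Φ'' = p ∘ |·|`), Itô's formula with the martingale Itô integral `∫ γ Φ'(D) dB` and Fubini give
`E|D_t| - δ ≤ K ∫₀ᵗ E|D_s| ds + ½ ∫ p dν`, `ν` the expected occupation measure of `|D|` on `[0,T]`
weighted by `γ² ds`; `∫_{(0,∞)} ρ⁻¹ dν ≤ T`, so `p` can be chosen with `∫ p dν ≤ ε`
(`exists_testDensity`); then Gronwall. This is the argument of Yamada–Watanabe (1971), Thm 1,
resp. "E[|Y¹_t - Y²_t|] ≤ C_t ∫₀ᵗ E[|Y¹_s - Y²_s|] ds … Gronwall" in Revuz–Yor's proof of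
IX (3.5)(ii), with the local time `L⁰ = 0` input (Cor. (3.4)) replaced by the occupation-measure
choice of `Φ''`.
[cite: RevuzYor1999, Ch. IX Thm (3.5)(ii)] -/
theorem ae_eq_zero_of_yamadaWatanabe
    {ρ : ℝ → ℝ} (hρm : Measurable ρ) (hρpos : ∀ a, 0 < a → 0 < ρ a)
    (hρint : ∀ ε, 0 < ε → ¬ IntegrableOn (fun a ↦ (ρ a)⁻¹) (Set.Ioo 0 ε))
    {D β γ : ℝ≥0 → (ℝ≥0 → ℝ) → ℝ}
    (hDp : IsStronglyProgressive brownianFiltration D)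
    (hβp : IsStronglyProgressive brownianFiltration β)
    (hγp : IsStronglyProgressive brownianFiltration γ)
    (hD : IsItoProcess D β γ brownian brownianFiltration preWienerMeasure)
    (hD0 : ∀ ω, D 0 ω = 0) {M K : ℝ} {T : ℝ≥0} (hK : 0 ≤ K)
    (hDbdd : ∀ᵐ ω ∂preWienerMeasure, ∀ s, |D s ω| ≤ M)
    (hβle : ∀ᵐ ω ∂preWienerMeasure, ∀ s : ℝ≥0, s ≤ T → |β s ω| ≤ K * |D s ω|)
    (hγsq : ∀ t : ℝ≥0, ∫⁻ ω, (∫⁻ s in Set.Icc (0 : ℝ) t,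
      ENNReal.ofReal (γ s.toNNReal ω ^ 2)) ∂preWienerMeasure ≠ ∞)
    (hγρ : ∀ᵐ ω ∂preWienerMeasure, ∀ s, D s ω ≠ 0 → γ s ω ^ 2 ≤ ρ |D s ω|)
    (hγ0 : ∀ᵐ ω ∂preWienerMeasure, ∀ s, D s ω = 0 → γ s ω = 0) :
    ∀ s : ℝ≥0, s ≤ T → ∀ᵐ ω ∂preWienerMeasure, D s ω = 0 := by
  haveI := isProbabilityMeasure_preWienerMeasure'
  -- joint measurability on `Ω × ℝ` (real time read through `Real.toNNReal`)
  have hDm := measurable_toNNReal_of_isStronglyProgressive hDp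
  have hβm := measurable_toNNReal_of_isStronglyProgressive hβp
  have hγm := measurable_toNNReal_of_isStronglyProgressive hγp
  have hDtm : ∀ t, Measurable (D t) := fun t ↦
    ((hDp.stronglyAdapted t).mono (brownianFiltration.le t)).measurable
  have habsD_m : Measurable fun z : (ℝ≥0 → ℝ) × ℝ ↦ |D z.2.toNNReal z.1| :=
    continuous_abs.measurable.comp hDm
  -- transfer of a.s. statements to product measures `W ⊗ μt`
  have hae_prod : ∀ {P : (ℝ≥0 → ℝ) → ℝ → Prop} (μt : Measure ℝ),
      (∀ᵐ ω ∂preWienerMeasure, ∀ s, P ω s) →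
        ∀ᵐ z ∂(preWienerMeasure.prod μt), P z.1 z.2 :=
    fun μt h ↦ (Measure.quasiMeasurePreserving_fst.ae h).mono fun z hz ↦ hz z.2
  -- the function `u(t) = E|D_t|`
  set u : ℝ → ℝ := fun t ↦ ∫ ω, |D t.toNNReal ω| ∂preWienerMeasure with hu
  have hDint : ∀ t : ℝ≥0, Integrable (fun ω ↦ |D t ω|) preWienerMeasure := fun t ↦
    Integrable.of_bound (continuous_abs.measurable.comp (hDtm t)).aestronglyMeasurable M
      (hDbdd.mono fun ω h ↦ by rw [Real.norm_eq_abs, abs_abs]; exact h t)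
  have hu_nonneg : ∀ t, 0 ≤ u t := fun t ↦ integral_nonneg fun ω ↦ abs_nonneg _
  have hu_le : ∀ t, u t ≤ M := fun t ↦ by
    have := integral_mono_ae (hDint _) (integrable_const M) (hDbdd.mono fun ω h ↦ h t.toNNReal)
    simpa using this
  have hu_meas : Measurable u := by
    have h1 : StronglyMeasurable (fun z : ℝ × (ℝ≥0 → ℝ) ↦ |D z.1.toNNReal z.2|) :=
      (continuous_abs.measurable.comp (hDm.comp measurable_swap)).stronglyMeasurable
    exact (h1.integral_prod_right' (ν := preWienerMeasure)).measurable
  -- Fubini for `E ∫₀ᵗ |D_s| ds`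
  have hFint : ∀ t : ℝ, Integrable (fun z : (ℝ≥0 → ℝ) × ℝ ↦ |D z.2.toNNReal z.1|)
      (preWienerMeasure.prod (volume.restrict (Set.Ioc (0 : ℝ) t))) := fun t ↦ by
    haveI : IsFiniteMeasure (volume.restrict (Set.Ioc (0 : ℝ) t)) :=
      isFiniteMeasure_restrict.2 (by simp)
    have h' : ∀ᵐ ω ∂preWienerMeasure, ∀ s : ℝ, ‖|D s.toNNReal ω|‖ ≤ M :=
      hDbdd.mono fun ω h s ↦ by rw [Real.norm_eq_abs, abs_abs]; exact h _
    exact Integrable.of_bound habsD_m.aestronglyMeasurable M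
      (hae_prod (P := fun ω s ↦ ‖|D s.toNNReal ω|‖ ≤ M) _ h')
  have hFubini : ∀ t : ℝ, 0 ≤ t →
      ∫ ω, (∫ s in Set.Ioc (0 : ℝ) t, |D s.toNNReal ω|) ∂preWienerMeasure =
        ∫ s in (0 : ℝ)..t, u s := by
    intro t ht
    rw [intervalIntegral.integral_of_le ht]
    exact integral_integral_swap (hFint t)
  -- the weighted expected occupation measure `ν` of `|D|` on `[0, T]`
  set πT : Measure ((ℝ≥0 → ℝ) × ℝ) :=
    preWienerMeasure.prod (volume.restrict (Set.Ioc (0 : ℝ) T)) with hπT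
  haveI hvolT : IsFiniteMeasure (volume.restrict (Set.Ioc (0 : ℝ) T)) :=
    isFiniteMeasure_restrict.2 (by simp)
  haveI : IsFiniteMeasure πT := by rw [hπT]; infer_instance
  set dens : (ℝ≥0 → ℝ) × ℝ → ℝ≥0 := fun z ↦ (γ z.2.toNNReal z.1 ^ 2).toNNReal with hdens
  have hdens_m : Measurable dens := (hγm.pow_const 2).real_toNNReal
  have hdens_eq : ∀ z, (dens z : ℝ≥0∞) = ENNReal.ofReal (γ z.2.toNNReal z.1 ^ 2) := fun z ↦ rfl
  set ν : Measure ℝ := (πT.withDensity fun z ↦ (dens z : ℝ≥0∞)).map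
    fun z ↦ |D z.2.toNNReal z.1| with hν
  have hγ2_lint : ∫⁻ z, (dens z : ℝ≥0∞) ∂πT ≠ ∞ := by
    have h1 : ∫⁻ z, (dens z : ℝ≥0∞) ∂πT = ∫⁻ ω, (∫⁻ s in Set.Ioc (0 : ℝ) T,
        ENNReal.ofReal (γ s.toNNReal ω ^ 2)) ∂preWienerMeasure := by
      rw [hπT, lintegral_prod _ hdens_m.coe_nnreal_ennreal.aemeasurable]
      exact lintegral_congr fun ω ↦ lintegral_congr fun s ↦ rfl
    rw [h1]
    exact ne_top_of_le_ne_top (hγsq T)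
      (lintegral_mono fun ω ↦ lintegral_mono_set Set.Ioc_subset_Icc_self)
  have hγ2_int : Integrable (fun z : (ℝ≥0 → ℝ) × ℝ ↦ γ z.2.toNNReal z.1 ^ 2) πT := by
    refine ⟨(hγm.pow_const 2).aestronglyMeasurable, ?_⟩
    rw [hasFiniteIntegral_iff_ofReal (ae_of_all _ fun z ↦ sq_nonneg _)]
    exact lt_top_iff_ne_top.2 hγ2_lint
  haveI : IsFiniteMeasure ν := by
    refine ⟨?_⟩
    rw [hν, Measure.map_apply habsD_m MeasurableSet.univ, Set.preimage_univ,
      withDensity_apply _ MeasurableSet.univ, Measure.restrict_univ]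
    exact lt_top_iff_ne_top.2 hγ2_lint
  -- `∫_{(0,∞)} ρ⁻¹ dν ≤ T < ∞`, from `γ² ≤ ρ(|D|) 𝟙_{D ≠ 0}`
  have hγρ' : ∀ᵐ ω ∂preWienerMeasure, ∀ s : ℝ,
      ENNReal.ofReal (γ s.toNNReal ω ^ 2) *
        (Set.Ioi (0 : ℝ)).indicator (fun a ↦ ENNReal.ofReal (ρ a)⁻¹) |D s.toNNReal ω| ≤ 1 := by
    filter_upwards [hγρ, hγ0] with ω h1 h2 s
    by_cases hD0' : D s.toNNReal ω = 0
    · rw [hD0', abs_zero, Set.indicator_of_notMem (fun h : (0 : ℝ) ∈ Set.Ioi 0 ↦ lt_irrefl _ h),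
        mul_zero]
      exact zero_le_one
    · have hpos : 0 < |D s.toNNReal ω| := abs_pos.2 hD0'
      rw [Set.indicator_of_mem (show |D s.toNNReal ω| ∈ Set.Ioi 0 from hpos),
        ← ENNReal.ofReal_mul (sq_nonneg _), ← ENNReal.ofReal_one]
      refine ENNReal.ofReal_le_ofReal ?_
      rw [← div_eq_mul_inv, div_le_one (hρpos _ hpos)]
      exact h1 _ hD0'
  have hν_fin : ∫⁻ a in Set.Ioi 0, ENNReal.ofReal (ρ a)⁻¹ ∂ν ≠ ∞ := by
    have hmeas_ind : Measurable fun a : ℝ ↦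
        (Set.Ioi (0 : ℝ)).indicator (fun a ↦ ENNReal.ofReal (ρ a)⁻¹) a :=
      (hρm.inv.ennreal_ofReal).indicator measurableSet_Ioi
    have hg_m : Measurable fun z : (ℝ≥0 → ℝ) × ℝ ↦
        (Set.Ioi (0 : ℝ)).indicator (fun a ↦ ENNReal.ofReal (ρ a)⁻¹) |D z.2.toNNReal z.1| :=
      hmeas_ind.comp habsD_m
    rw [← lintegral_indicator measurableSet_Ioi, hν, lintegral_map hmeas_ind habsD_m,
      lintegral_withDensity_eq_lintegral_mul _ hdens_m.coe_nnreal_ennreal hg_m]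
    have hle : ∀ᵐ z ∂πT, ((fun z ↦ (dens z : ℝ≥0∞)) * fun z : (ℝ≥0 → ℝ) × ℝ ↦
        (Set.Ioi (0 : ℝ)).indicator (fun a ↦ ENNReal.ofReal (ρ a)⁻¹) |D z.2.toNNReal z.1|) z ≤
          1 := by
      filter_upwards [hae_prod (P := fun ω s ↦ ENNReal.ofReal (γ s.toNNReal ω ^ 2) *
        (Set.Ioi (0 : ℝ)).indicator (fun a ↦ ENNReal.ofReal (ρ a)⁻¹) |D s.toNNReal ω| ≤ 1)
        (volume.restrict (Set.Ioc (0 : ℝ) T)) hγρ'] with z hz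
      simp only [Pi.mul_apply, hdens_eq]
      exact hz
    refine ne_top_of_le_ne_top ?_ (lintegral_mono_ae hle)
    rw [lintegral_const, one_mul]
    exact measure_ne_top _ _
  -- the occupation formula `∫ φ dν = E ∫₀ᵀ γ² φ(|D|) ds` for bounded continuous `φ`
  have hoccup : ∀ {φ : ℝ → ℝ}, Continuous φ → (∃ C, ∀ x, ‖φ x‖ ≤ C) →
      ∫ x, φ x ∂ν = ∫ ω, (∫ s in Set.Ioc (0 : ℝ) T,
        γ s.toNNReal ω ^ 2 * φ |D s.toNNReal ω|) ∂preWienerMeasure := by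
    intro φ hφ hφbd
    obtain ⟨C, hC⟩ := hφbd
    have hC0 : 0 ≤ C := (norm_nonneg _).trans (hC 0)
    have hsmul : (fun z : (ℝ≥0 → ℝ) × ℝ ↦ dens z • φ |D z.2.toNNReal z.1|) =
        fun z ↦ γ z.2.toNNReal z.1 ^ 2 * φ |D z.2.toNNReal z.1| := by
      funext z
      rw [NNReal.smul_def, smul_eq_mul, hdens, Real.coe_toNNReal _ (sq_nonneg _)]
    have hint : Integrable (fun z : (ℝ≥0 → ℝ) × ℝ ↦
        γ z.2.toNNReal z.1 ^ 2 * φ |D z.2.toNNReal z.1|) πT := by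
      refine Integrable.mono' (hγ2_int.mul_const C)
        ((hγm.pow_const 2).mul (hφ.measurable.comp habsD_m)).aestronglyMeasurable
        (ae_of_all _ fun z ↦ ?_)
      rw [norm_mul, Real.norm_eq_abs, abs_of_nonneg (sq_nonneg _)]
      exact mul_le_mul_of_nonneg_left (hC _) (sq_nonneg _)
    rw [hν, integral_map habsD_m.aemeasurable hφ.aestronglyMeasurable,
      integral_withDensity_eq_integral_smul hdens_m, hsmul, hπT, integral_prod _ (hπT ▸ hint)]
  -- **Gronwall's hypothesis** `u(t) ≤ K ∫₀ᵗ u` on `[0, T]`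
  have hmain : ∀ t ∈ Set.Icc (0 : ℝ) T, u t ≤ K * ∫ s in (0 : ℝ)..t, u s := by
    intro t ht
    refine le_of_forall_pos_le_add fun η hη ↦ ?_
    have hη2 : 0 < η / 2 := half_pos hη
    obtain ⟨p, hpc, hpcs, hp0, hpsupp, hpint, -, hpε⟩ :=
      exists_testDensity hρm hρpos hρint ν hν_fin hη2 hη
    -- the test function `Φ = ywFun p`
    have hΦc2 : ContDiff ℝ 2 (ywFun p) := contDiff_ywFun hpc
    have hΦ'c : Continuous (deriv (ywFun p)) := by
      rw [deriv_ywFun hpc]; exact continuous_ywDeriv hpc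
    have hΦ'bd : ∀ x, |deriv (ywFun p) x| ≤ 1 := fun x ↦ by
      rw [deriv_ywFun hpc]; exact abs_ywDeriv_le_one hpc hp0 hpsupp hpint hη2 x
    have hΦlow : ∀ x, |x| - η / 2 ≤ ywFun p x := sub_le_ywFun hpc hp0 hpsupp hpint hη2
    have hΦabs : ∀ x, |ywFun p x| ≤ |x| := abs_ywFun_le_abs hpc hp0 hpsupp hpint hη2
    have hΦ'' : iteratedDeriv 2 (ywFun p) = fun x ↦ p |x| := iteratedDeriv_two_ywFun hpc
    obtain ⟨Cp, hCp⟩ := hpc.bounded_above_of_compact_support hpcs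
    -- the martingale Itô integral `Kp = ∫ γ Φ'(D) dB`
    have hgp : IsStronglyProgressive brownianFiltration
        fun s ω ↦ γ s ω * deriv (ywFun p) (D s ω) :=
      hγp.mul (IsStronglyProgressive.continuous_comp hDp hΦ'c)
    have hgsq : ∀ t' : ℝ≥0, ∫⁻ ω, (∫⁻ s in Set.Icc (0 : ℝ) t', ENNReal.ofReal
        ((γ s.toNNReal ω * deriv (ywFun p) (D s.toNNReal ω)) ^ 2)) ∂preWienerMeasure ≠ ∞ := by
      intro t'
      refine ne_top_of_le_ne_top (hγsq t')
        (lintegral_mono fun ω ↦ lintegral_mono fun s ↦ ENNReal.ofReal_le_ofReal ?_)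
      rw [mul_pow]
      exact mul_le_of_le_one_right (sq_nonneg _) ((sq_le_one_iff_abs_le_one _).2 (hΦ'bd _))
    obtain ⟨Kp, hKp, hKpM, -⟩ := exists_isItoIntegral_of_sq_integrable hgp hgsq
    -- Itô's formula for `Φ(D)`
    have hf2 : ContDiff ℝ 2 (Function.uncurry fun (_ : ℝ) ↦ ywFun p) := hΦc2.comp contDiff_snd
    have hito := ito_formula_itoProcess_ae_holds (fun (_ : ℝ) ↦ ywFun p) hf2
      (fun s ↦ (hDp.stronglyAdapted s).measurable) hγp hD hKp
    -- the time `t` as an element of `ℝ≥0`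
    set tN : ℝ≥0 := t.toNNReal with htN
    have htNt : (tN : ℝ) = t := Real.coe_toNNReal t ht.1
    have htNT : tN ≤ T := Real.toNNReal_le_iff_le_coe.2 ht.2
    -- a.s. path integrability of `γ²` on `[0, T]`
    have hγpath : ∀ᵐ ω ∂preWienerMeasure,
        IntegrableOn (fun s : ℝ ↦ γ s.toNNReal ω ^ 2) (Set.Icc 0 T) := by
      have hmeas : Measurable fun ω ↦ ∫⁻ s in Set.Icc (0 : ℝ) T,
          ENNReal.ofReal (γ s.toNNReal ω ^ 2) :=
        ((hγm.pow_const 2).ennreal_ofReal).lintegral_prod_right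
          (ν := volume.restrict (Set.Icc (0 : ℝ) T))
      filter_upwards [ae_lt_top hmeas (hγsq T)] with ω hω
      exact ⟨((measurable_path_of_measurable_toNNReal hγm ω).pow_const 2).aestronglyMeasurable,
        (hasFiniteIntegral_iff_ofReal (ae_of_all _ fun s ↦ sq_nonneg _)).2 hω⟩
    -- the pathwise inequality at time `t`
    have hpath : ∀ᵐ ω ∂preWienerMeasure,
        ywFun p (D tN ω) ≤ K * (∫ s in Set.Ioc (0 : ℝ) t, |D s.toNNReal ω|) +
          2⁻¹ * (∫ s in Set.Ioc (0 : ℝ) T, γ s.toNNReal ω ^ 2 * p |D s.toNNReal ω|) +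
            Kp tN ω := by
      filter_upwards [hito, hD.1, hγpath, hβle, hDbdd] with ω hI hβi hγi hβ hDb
      have hβpm : Measurable fun r : ℝ ↦ β r.toNNReal ω := measurable_path_of_measurable_toNNReal hβm ω
      have hDpm : Measurable fun r : ℝ ↦ D r.toNNReal ω := measurable_path_of_measurable_toNNReal hDm ω
      have hγpm : Measurable fun r : ℝ ↦ γ r.toNNReal ω := measurable_path_of_measurable_toNNReal hγm ω
      -- integrability on `(0, t]` and `(0, T]`
      have hI1 : IntegrableOn (fun s : ℝ ↦ β s.toNNReal ω * deriv (ywFun p) (D s.toNNReal ω))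
          (Set.Ioc 0 t) := by
        refine Integrable.mono' ((hβi tN).mono_set ?_).norm ?_ (ae_of_all _ fun s ↦ ?_)
        · rw [htNt]; exact Set.Ioc_subset_Icc_self
        · exact (hβpm.mul (hΦ'c.measurable.comp hDpm)).aestronglyMeasurable
        · rw [norm_mul, Real.norm_eq_abs, Real.norm_eq_abs]
          exact mul_le_of_le_one_right (abs_nonneg _) (hΦ'bd _)
      have hI3 : IntegrableOn (fun s : ℝ ↦ K * |D s.toNNReal ω|) (Set.Ioc 0 t) := by
        haveI : IsFiniteMeasure (volume.restrict (Set.Ioc (0 : ℝ) t)) :=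
          isFiniteMeasure_restrict.2 (by simp)
        refine Integrable.of_bound ?_ (K * M) (ae_of_all _ fun s ↦ ?_)
        · exact (measurable_const.mul (continuous_abs.measurable.comp hDpm)).aestronglyMeasurable
        · rw [Real.norm_eq_abs, abs_mul, abs_abs, abs_of_nonneg hK]
          exact mul_le_mul_of_nonneg_left (hDb _) hK
      have hI2T : IntegrableOn (fun s : ℝ ↦ γ s.toNNReal ω ^ 2 * p |D s.toNNReal ω|)
          (Set.Ioc 0 T) := by
        refine Integrable.mono' ((hγi.mono_set Set.Ioc_subset_Icc_self).mul_const Cp) ?_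
          (ae_of_all _ fun s ↦ ?_)
        · exact ((hγpm.pow_const 2).mul
            (hpc.measurable.comp (continuous_abs.measurable.comp hDpm))).aestronglyMeasurable
        · rw [norm_mul, Real.norm_eq_abs, abs_of_nonneg (sq_nonneg _)]
          exact mul_le_mul_of_nonneg_left (hCp _) (sq_nonneg _)
      have hI2 : IntegrableOn (fun s : ℝ ↦ 2⁻¹ * (γ s.toNNReal ω ^ 2 * p |D s.toNNReal ω|))
          (Set.Ioc 0 t) :=
        (hI2T.mono_set (Set.Ioc_subset_Ioc_right ht.2)).const_mul _
      -- Itô's formula at time `tN`, rewritten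
      have hI' := hI tN
      simp only [deriv_const, zero_add, hD0 ω, ywFun_zero, hΦ''] at hI'
      rw [hI', htNt, intervalIntegral.integral_of_le ht.1]
      have hfun : (fun s : ℝ ↦ β s.toNNReal ω * deriv (ywFun p) (D s.toNNReal ω) +
          2⁻¹ * γ s.toNNReal ω ^ 2 * p |D s.toNNReal ω|) =
          fun s : ℝ ↦ β s.toNNReal ω * deriv (ywFun p) (D s.toNNReal ω) +
            2⁻¹ * (γ s.toNNReal ω ^ 2 * p |D s.toNNReal ω|) := by
        funext s; ring
      rw [hfun, integral_add hI1 hI2, integral_const_mul]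
      have h1 : ∫ s in Set.Ioc 0 t, β s.toNNReal ω * deriv (ywFun p) (D s.toNNReal ω) ≤
          ∫ s in Set.Ioc 0 t, K * |D s.toNNReal ω| := by
        refine setIntegral_mono_on hI1 hI3 measurableSet_Ioc fun s hs ↦ ?_
        have hsT : s.toNNReal ≤ T := Real.toNNReal_le_iff_le_coe.2 (hs.2.trans ht.2)
        calc β s.toNNReal ω * deriv (ywFun p) (D s.toNNReal ω)
            ≤ |β s.toNNReal ω * deriv (ywFun p) (D s.toNNReal ω)| := le_abs_self _
          _ = |β s.toNNReal ω| * |deriv (ywFun p) (D s.toNNReal ω)| := abs_mul _ _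
          _ ≤ K * |D s.toNNReal ω| * 1 :=
            mul_le_mul (hβ _ hsT) (hΦ'bd _) (abs_nonneg _) (mul_nonneg hK (abs_nonneg _))
          _ = K * |D s.toNNReal ω| := mul_one _
      have h2 : ∫ s in Set.Ioc (0 : ℝ) t, γ s.toNNReal ω ^ 2 * p |D s.toNNReal ω| ≤
          ∫ s in Set.Ioc (0 : ℝ) T, γ s.toNNReal ω ^ 2 * p |D s.toNNReal ω| :=
        setIntegral_mono_set hI2T (ae_of_all _ fun s ↦ mul_nonneg (sq_nonneg _) (hp0 _))
          (Set.Ioc_subset_Ioc_right ht.2).eventuallyLE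
      rw [integral_const_mul] at h1
      have h2' := mul_le_mul_of_nonneg_left h2 (by norm_num : (0 : ℝ) ≤ 2⁻¹)
      linarith
    -- integrate the pathwise inequality
    have hΦint : Integrable (fun ω ↦ ywFun p (D tN ω)) preWienerMeasure :=
      Integrable.of_bound ((continuous_ywFun hpc).measurable.comp (hDtm tN)).aestronglyMeasurable
        M (hDbdd.mono fun ω h ↦ by rw [Real.norm_eq_abs]; exact (hΦabs _).trans (h _))
    have hA_int : Integrable (fun ω ↦ ∫ s in Set.Ioc (0 : ℝ) t, |D s.toNNReal ω|)
        preWienerMeasure :=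
      (hFint t).integral_prod_left
    have hG_int : Integrable (fun z : (ℝ≥0 → ℝ) × ℝ ↦
        γ z.2.toNNReal z.1 ^ 2 * p |D z.2.toNNReal z.1|) πT := by
      refine Integrable.mono' (hγ2_int.mul_const Cp)
        ((hγm.pow_const 2).mul (hpc.measurable.comp habsD_m)).aestronglyMeasurable
        (ae_of_all _ fun z ↦ ?_)
      rw [norm_mul, Real.norm_eq_abs, abs_of_nonneg (sq_nonneg _)]
      exact mul_le_mul_of_nonneg_left (hCp _) (sq_nonneg _)
    have hB_int : Integrable (fun ω ↦ ∫ s in Set.Ioc (0 : ℝ) T,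
        γ s.toNNReal ω ^ 2 * p |D s.toNNReal ω|) preWienerMeasure :=
      (hπT ▸ hG_int).integral_prod_left
    have hKint : Integrable (Kp tN) preWienerMeasure := hKpM.integrable tN
    have hEK : ∫ ω, Kp tN ω ∂preWienerMeasure = 0 := by
      have h := hKpM.setIntegral_eq (zero_le : (0 : ℝ≥0) ≤ tN)
        (MeasurableSet.univ (m := brownianFiltration 0))
      rw [setIntegral_univ, setIntegral_univ] at h
      rw [← h]
      simp [hKp.apply_zero]
    have hRHSint : Integrable (fun ω ↦ K * (∫ s in Set.Ioc (0 : ℝ) t, |D s.toNNReal ω|) +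
        2⁻¹ * (∫ s in Set.Ioc (0 : ℝ) T, γ s.toNNReal ω ^ 2 * p |D s.toNNReal ω|) + Kp tN ω)
        preWienerMeasure :=
      ((hA_int.const_mul K).add (hB_int.const_mul 2⁻¹)).add hKint
    have h12int : Integrable (fun ω ↦ K * (∫ s in Set.Ioc (0 : ℝ) t, |D s.toNNReal ω|) +
        2⁻¹ * (∫ s in Set.Ioc (0 : ℝ) T, γ s.toNNReal ω ^ 2 * p |D s.toNNReal ω|))
        preWienerMeasure :=
      (hA_int.const_mul K).add (hB_int.const_mul 2⁻¹)
    have hE := integral_mono_ae hΦint hRHSint hpath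
    rw [integral_add h12int hKint, integral_add (hA_int.const_mul K) (hB_int.const_mul 2⁻¹),
      integral_const_mul, integral_const_mul, hEK, add_zero, hFubini t ht.1] at hE
    -- the lower bound `u t - η/2 ≤ E Φ(D_t)`
    have hlow : u t - η / 2 ≤ ∫ ω, ywFun p (D tN ω) ∂preWienerMeasure := by
      have h1 : ∫ ω, (|D tN ω| - η / 2) ∂preWienerMeasure ≤
          ∫ ω, ywFun p (D tN ω) ∂preWienerMeasure :=
        integral_mono ((hDint tN).sub (integrable_const _)) hΦint fun ω ↦ hΦlow _
      rw [integral_sub (hDint tN) (integrable_const _), integral_const, smul_eq_mul] at h1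
      simpa using h1
    -- the occupation bound `E ∫₀ᵀ γ² p(|D|) = ∫ p dν ≤ η`
    have hocc : ∫ ω, (∫ s in Set.Ioc (0 : ℝ) T, γ s.toNNReal ω ^ 2 * p |D s.toNNReal ω|)
        ∂preWienerMeasure ≤ η := by
      rw [← hoccup hpc ⟨Cp, hCp⟩]
      exact hpε
    have hint_nonneg : 0 ≤ ∫ s in (0 : ℝ)..t, u s :=
      intervalIntegral.integral_nonneg ht.1 fun s _ ↦ hu_nonneg s
    nlinarith
  -- **Gronwall**
  have hzero := eq_zero_of_le_integral hK T.coe_nonneg hu_meas (fun t _ ↦ hu_nonneg t)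
    ⟨M, fun t _ ↦ hu_le t⟩ hmain
  intro s hs
  have h0 : ∫ ω, |D s ω| ∂preWienerMeasure = 0 := by
    have := hzero s ⟨s.coe_nonneg, NNReal.coe_le_coe.2 hs⟩
    simpa [hu] using this
  have hae := (integral_eq_zero_iff_of_nonneg_ae (ae_of_all _ fun ω ↦ abs_nonneg (D s ω))
    (hDint s)).1 h0
  filter_upwards [hae] with ω hω using abs_eq_zero.1 hω

/-! ### Localised pathwise uniqueness -/

/-- **Localised uniqueness under the Yamada–Watanabe hypotheses.** On the canonical space, for two
progressively measurable solutions `X, Y` (raw Brownian filtration) of `dX = b(t,X) dt + σ(t,X) dB`,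
`X₀ = Y₀ = x₀`, with `b, σ` jointly Borel, `σ` locally bounded, `(σ(s,x) - σ(s,y))² ≤ ρ(|x - y|)`
(`x ≠ y`, `ρ > 0` Borel on `(0,∞)` with `∫_{0+} da/ρ(a) = ∞`) and `b` Lipschitz in `x` on compacts
locally uniformly in time, and an optional time `τ` of the raw filtration before which both stay
bounded by `L` (a.s.), the stopped processes `X^τ`, `Y^τ` agree at every time almost surely. This
is "`Yⁱ = (Xⁱ)^{Tₙ}` … `E[|Y¹_t - Y²_t|] ≤ C_t ∫₀ᵗ E[|Y¹_s - Y²_s|] ds` … Gronwall" in the proof of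
Revuz–Yor IX (3.5)(ii), with the optional times of the raw filtration in place of `Tₙ` and the
Yamada–Watanabe estimate `ae_eq_zero_of_yamadaWatanabe` in place of Cor. (3.4) + Tanaka.
The stopped difference is realised as the Itô process
`∫₀ 𝟙_{[0,τ]}(b(Y) - b(X)) ds + (N₂ - N₁)` exactly as in `IsStrongSolution.stopped_ae_eq`
(truncation fact S4 `exists_itoIntegral_truncation_of_sq_integrable_holds`, martingale integrals
`exists_isItoIntegral_of_sq_integrable`, uniqueness `IsItoIntegral.unique_holds`, linearity
`IsItoIntegral.sub_of_martingale`).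
Revuz–Yor, *Continuous Martingales and Brownian Motion* (1999), Ch. IX, Thm (3.5)(ii) (proof).
[cite: RevuzYor1999, Ch. IX Thm (3.5)(ii)] -/
theorem IsStrongSolution.stopped_ae_eq_of_sq_sub_le
    {b σ : ℝ → ℝ → ℝ} {ρ : ℝ → ℝ} {x₀ : ℝ}
    (hbm : Measurable (Function.uncurry b)) (hσm : Measurable (Function.uncurry σ))
    (hρm : Measurable ρ) (hρpos : ∀ a, 0 < a → 0 < ρ a)
    (hρint : ∀ ε, 0 < ε → ¬ IntegrableOn (fun a ↦ (ρ a)⁻¹) (Set.Ioo 0 ε))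
    (hσbd : ∀ t R : ℝ, ∃ C : ℝ, ∀ s ∈ Set.Icc 0 t, ∀ x ∈ Set.Icc (-R) R, |σ s x| ≤ C)
    (hσρ : ∀ s x y, x ≠ y → (σ s x - σ s y) ^ 2 ≤ ρ |x - y|)
    (hbL : ∀ t R : ℝ, ∃ K : ℝ, ∀ s ∈ Set.Icc 0 t, ∀ x ∈ Set.Icc (-R) R, ∀ y ∈ Set.Icc (-R) R,
      |b s x - b s y| ≤ K * |x - y|)
    {X Y : ℝ≥0 → (ℝ≥0 → ℝ) → ℝ}
    (hXp : IsStronglyProgressive brownianFiltration X)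
    (hYp : IsStronglyProgressive brownianFiltration Y)
    (hX : IsStrongSolution b σ x₀ X brownian brownianFiltration preWienerMeasure)
    (hY : IsStrongSolution b σ x₀ Y brownian brownianFiltration preWienerMeasure)
    {τ : (ℝ≥0 → ℝ) → WithTop ℝ≥0}
    (hτ : ∀ t : ℝ≥0, MeasurableSet[brownianFiltration t] {ω | τ ω < t}) {L : ℝ}
    (hbound : ∀ᵐ ω ∂preWienerMeasure, ∀ s : ℝ≥0, (s : WithTop ℝ≥0) ≤ τ ω →
      |X s ω| ≤ L ∧ |Y s ω| ≤ L)
    (T : ℝ≥0) :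
    ∀ s ≤ T, ∀ᵐ ω ∂preWienerMeasure, stoppedProcess Y τ s ω = stoppedProcess X τ s ω := by
  haveI := isProbabilityMeasure_preWienerMeasure'
  obtain ⟨hX0, -, hXint, JX, hJX, hXeq⟩ := hX
  obtain ⟨hY0, -, hYint, JY, hJY, hYeq⟩ := hY
  have hbX : ∀ᵐ ω ∂preWienerMeasure, ∀ s : ℝ≥0, (s : WithTop ℝ≥0) ≤ τ ω → |X s ω| ≤ L :=
    hbound.mono fun ω h s hs ↦ (h s hs).1
  have hbY : ∀ᵐ ω ∂preWienerMeasure, ∀ s : ℝ≥0, (s : WithTop ℝ≥0) ≤ τ ω → |Y s ω| ≤ L :=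
    hbound.mono fun ω h s hs ↦ (h s hs).2
  -- the truncated diffusion coefficients: progressive and square integrable
  have hH1p : IsStronglyProgressive brownianFiltration (trunc τ (along σ X)) :=
    isStronglyProgressive_trunc (IsStronglyProgressive.comp_measurable₂ hXp hσm) hτ
  have hH2p : IsStronglyProgressive brownianFiltration (trunc τ (along σ Y)) :=
    isStronglyProgressive_trunc (IsStronglyProgressive.comp_measurable₂ hYp hσm) hτ
  have hfin1 := lintegral_trunc_along_sq_ne_top_of_locally_bounded (τ := τ) hσbd hbX
  have hfin2 := lintegral_trunc_along_sq_ne_top_of_locally_bounded (τ := τ) hσbd hbY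
  -- truncated Itô integrals (S4), martingale Itô integrals and their progressive versions
  obtain ⟨J1, hJ1, hJ1eq⟩ := exists_itoIntegral_truncation_of_sq_integrable_holds
    (IsStronglyProgressive.comp_measurable₂ hXp hσm) hJX hτ hfin1
  obtain ⟨J2, hJ2, hJ2eq⟩ := exists_itoIntegral_truncation_of_sq_integrable_holds
    (IsStronglyProgressive.comp_measurable₂ hYp hσm) hJY hτ hfin2
  obtain ⟨M1, hM1, hM1M, -⟩ := exists_isItoIntegral_of_sq_integrable hH1p hfin1
  obtain ⟨M2, hM2, hM2M, -⟩ := exists_isItoIntegral_of_sq_integrable hH2p hfin2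
  obtain ⟨N1, hN1, hN1p, -, hN1eq⟩ := hM1.exists_isStronglyProgressive
  obtain ⟨N2, hN2, hN2p, -, hN2eq⟩ := hM2.exists_isStronglyProgressive
  have hN1J : ∀ᵐ ω ∂preWienerMeasure, ∀ t, N1 t ω = stoppedProcess JX τ t ω := by
    filter_upwards [hN1eq, IsItoIntegral.unique_holds hM1 hJ1, hJ1eq] with ω h1 h2 h3 t
    rw [h1 t, h2 t, h3 t]
  have hN2J : ∀ᵐ ω ∂preWienerMeasure, ∀ t, N2 t ω = stoppedProcess JY τ t ω := by
    filter_upwards [hN2eq, IsItoIntegral.unique_holds hM2 hJ2, hJ2eq] with ω h1 h2 h3 t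
    rw [h1 t, h2 t, h3 t]
  have hN1M : Martingale N1 brownianFiltration preWienerMeasure :=
    hM1M.congr hN1p.stronglyAdapted fun t ↦ hN1eq.mono fun ω h ↦ (h t).symm
  have hN2M : Martingale N2 brownianFiltration preWienerMeasure :=
    hM2M.congr hN2p.stronglyAdapted fun t ↦ hN2eq.mono fun ω h ↦ (h t).symm
  -- the Itô integral of the difference of the truncated coefficients (linearity)
  have hJd : IsItoIntegral (fun t ω ↦ trunc τ (along σ Y) t ω - trunc τ (along σ X) t ω) brownian
      (fun t ω ↦ N2 t ω - N1 t ω) brownianFiltration preWienerMeasure :=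
    hN2.sub_of_martingale hN1
      (measurable_path_of_measurable_toNNReal (measurable_toNNReal_of_isStronglyProgressive hH2p))
      (measurable_path_of_measurable_toNNReal (measurable_toNNReal_of_isStronglyProgressive hH1p))
      hN2M hN1M
  -- drift, diffusion coefficient and the difference process
  set β : ℝ≥0 → (ℝ≥0 → ℝ) → ℝ := trunc τ (fun s ω ↦ along b Y s ω - along b X s ω) with hβ
  set γ : ℝ≥0 → (ℝ≥0 → ℝ) → ℝ :=
    fun s ω ↦ trunc τ (along σ Y) s ω - trunc τ (along σ X) s ω with hγ
  set D : ℝ≥0 → (ℝ≥0 → ℝ) → ℝ := fun s ω ↦ timeIntegral β s ω + (N2 s ω - N1 s ω) with hD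
  have hβp : IsStronglyProgressive brownianFiltration β :=
    isStronglyProgressive_trunc ((IsStronglyProgressive.comp_measurable₂ hYp hbm).sub
      (IsStronglyProgressive.comp_measurable₂ hXp hbm)) hτ
  have hγp : IsStronglyProgressive brownianFiltration γ := hH2p.sub hH1p
  have hDp : IsStronglyProgressive brownianFiltration D :=
    (isStronglyProgressive_timeIntegral hβp).add (hN2p.sub hN1p)
  -- (i) `D` is the stopped difference `Y^τ - X^τ`
  have hDeq : ∀ᵐ ω ∂preWienerMeasure, ∀ s,
      D s ω = stoppedProcess Y τ s ω - stoppedProcess X τ s ω := by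
    filter_upwards [hXeq, hYeq, hXint, hYint, hN1J, hN2J] with ω hxe hye hxi hyi h1 h2 s
    have hsub : timeIntegral β s ω =
        timeIntegral (trunc τ (along b Y)) s ω - timeIntegral (trunc τ (along b X)) s ω := by
      simp only [timeIntegral, hβ]
      rw [← intervalIntegral.integral_sub]
      · congr 1
        funext r
        simp only [trunc_apply]
        split_ifs <;> ring
      · exact (intervalIntegrable_iff_integrableOn_Ioc_of_le s.coe_nonneg).2
          ((integrableOn_trunc (g := along b Y) (hyi s)).mono_set Set.Ioc_subset_Icc_self)
      · exact (intervalIntegrable_iff_integrableOn_Ioc_of_le s.coe_nonneg).2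
          ((integrableOn_trunc (g := along b X) (hxi s)).mono_set Set.Ioc_subset_Icc_self)
    rw [hD]
    dsimp only
    rw [hsub, timeIntegral_trunc, timeIntegral_trunc, h1 s, h2 s]
    simp only [stoppedProcess]
    rw [hxe, hye, hX0 ω, hY0 ω]
    simp only [timeIntegral, along]
    ring
  -- (ii) `D` is a.s. bounded by `2L`
  have hDbdd : ∀ᵐ ω ∂preWienerMeasure, ∀ s, |D s ω| ≤ 2 * L := by
    filter_upwards [hDeq, hbound] with ω hde hb s
    rw [hde s]
    simp only [stoppedProcess]
    obtain ⟨h1, h2⟩ := hb _ (coe_untopA_min_le s (τ ω))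
    calc |Y _ ω - X _ ω| ≤ |Y _ ω| + |X _ ω| := abs_sub _ _
      _ ≤ L + L := add_le_add h2 h1
      _ = 2 * L := by ring
  -- (iii) the drift bound `|β| ≤ K |D|` on `[0, T]`
  obtain ⟨Kb, hKb⟩ := hbL T L
  have hβle : ∀ᵐ ω ∂preWienerMeasure, ∀ r : ℝ≥0, r ≤ T → |β r ω| ≤ max Kb 0 * |D r ω| := by
    filter_upwards [hDeq, hbound] with ω hde hb r hrT
    rw [hde r, hβ]
    by_cases hr : (r : WithTop ℝ≥0) ≤ τ ω
    · rw [trunc_of_le hr, stoppedProcess_eq_of_le hr, stoppedProcess_eq_of_le hr]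
      simp only [along]
      obtain ⟨h1, h2⟩ := hb r hr
      have hrI : (r : ℝ) ∈ Set.Icc 0 (T : ℝ) := ⟨r.coe_nonneg, NNReal.coe_le_coe.2 hrT⟩
      calc |b r (Y r ω) - b r (X r ω)| ≤ Kb * |Y r ω - X r ω| :=
            hKb r hrI (Y r ω) (abs_le.1 h2) (X r ω) (abs_le.1 h1)
        _ ≤ max Kb 0 * |Y r ω - X r ω| :=
            mul_le_mul_of_nonneg_right (le_max_left _ _) (abs_nonneg _)
    · rw [trunc_of_not_le hr, abs_zero]
      exact mul_nonneg (le_max_right _ _) (abs_nonneg _)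
  -- (iv) the Hölder-type bounds on `γ`
  have hγD : ∀ᵐ ω ∂preWienerMeasure, ∀ r,
      (D r ω ≠ 0 → γ r ω ^ 2 ≤ ρ |D r ω|) ∧ (D r ω = 0 → γ r ω = 0) := by
    filter_upwards [hDeq] with ω hde r
    rw [hde r, hγ]
    by_cases hr : (r : WithTop ℝ≥0) ≤ τ ω
    · simp only [trunc_of_le hr, stoppedProcess_eq_of_le hr, along]
      refine ⟨fun hne ↦ hσρ r (Y r ω) (X r ω) (sub_ne_zero.1 hne), fun heq ↦ ?_⟩
      rw [sub_eq_zero.1 heq, sub_self]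
    · simp only [trunc_of_not_le hr, sub_self, ne_eq, OfNat.ofNat_ne_zero, not_false_eq_true,
        zero_pow, implies_true, and_true]
      intro hne
      exact (hρpos _ (abs_pos.2 hne)).le
  have hγρ' : ∀ᵐ ω ∂preWienerMeasure, ∀ r, D r ω ≠ 0 → γ r ω ^ 2 ≤ ρ |D r ω| :=
    hγD.mono fun ω h r ↦ (h r).1
  have hγ0 : ∀ᵐ ω ∂preWienerMeasure, ∀ r, D r ω = 0 → γ r ω = 0 :=
    hγD.mono fun ω h r ↦ (h r).2
  -- (v) square integrability of `γ`
  have hγsq : ∀ t : ℝ≥0, ∫⁻ ω, (∫⁻ s in Set.Icc (0 : ℝ) t,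
      ENNReal.ofReal (γ s.toNNReal ω ^ 2)) ∂preWienerMeasure ≠ ∞ := by
    intro t
    have hmY := measurable_toNNReal_of_isStronglyProgressive hH2p
    have hmX := measurable_toNNReal_of_isStronglyProgressive hH1p
    have hle : ∀ ω, (∫⁻ s in Set.Icc (0 : ℝ) t, ENNReal.ofReal (γ s.toNNReal ω ^ 2)) ≤
        2 * (∫⁻ s in Set.Icc (0 : ℝ) t, ENNReal.ofReal (trunc τ (along σ Y) s.toNNReal ω ^ 2)) +
        2 * (∫⁻ s in Set.Icc (0 : ℝ) t, ENNReal.ofReal (trunc τ (along σ X) s.toNNReal ω ^ 2)) := by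
      intro ω
      have hpY : Measurable fun s : ℝ ↦ ENNReal.ofReal (trunc τ (along σ Y) s.toNNReal ω ^ 2) :=
        ((measurable_path_of_measurable_toNNReal hmY ω).pow_const 2).ennreal_ofReal
      have hpX : Measurable fun s : ℝ ↦ ENNReal.ofReal (trunc τ (along σ X) s.toNNReal ω ^ 2) :=
        ((measurable_path_of_measurable_toNNReal hmX ω).pow_const 2).ennreal_ofReal
      rw [← lintegral_const_mul _ hpY, ← lintegral_const_mul _ hpX,
        ← lintegral_add_left (hpY.const_mul _)]
      refine lintegral_mono fun s ↦ ?_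
      rw [show (2 : ℝ≥0∞) = ENNReal.ofReal 2 by norm_num, ← ENNReal.ofReal_mul zero_le_two,
        ← ENNReal.ofReal_mul zero_le_two, ← ENNReal.ofReal_add (by positivity) (by positivity)]
      refine ENNReal.ofReal_le_ofReal ?_
      rw [hγ]
      nlinarith [sq_nonneg (trunc τ (along σ Y) s.toNNReal ω + trunc τ (along σ X) s.toNNReal ω)]
    have hAm : Measurable fun ω ↦ ∫⁻ s in Set.Icc (0 : ℝ) t,
        ENNReal.ofReal (trunc τ (along σ Y) s.toNNReal ω ^ 2) :=
      ((hmY.pow_const 2).ennreal_ofReal).lintegral_prod_right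
        (ν := volume.restrict (Set.Icc (0 : ℝ) t))
    have hBm : Measurable fun ω ↦ ∫⁻ s in Set.Icc (0 : ℝ) t,
        ENNReal.ofReal (trunc τ (along σ X) s.toNNReal ω ^ 2) :=
      ((hmX.pow_const 2).ennreal_ofReal).lintegral_prod_right
        (ν := volume.restrict (Set.Icc (0 : ℝ) t))
    refine ne_top_of_le_ne_top ?_ (lintegral_mono hle)
    rw [lintegral_add_left (hAm.const_mul _), lintegral_const_mul _ hAm, lintegral_const_mul _ hBm]
    exact ENNReal.add_ne_top.2 ⟨ENNReal.mul_ne_top (by norm_num) (hfin2 t),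
      ENNReal.mul_ne_top (by norm_num) (hfin1 t)⟩
  -- (vi) `D` is an Itô process with drift `β`, diffusion coefficient `γ` and `D₀ = 0`
  have hD0 : ∀ ω, D 0 ω = 0 := fun ω ↦ by
    simp only [hD, timeIntegral_apply_zero, hN1.apply_zero ω, hN2.apply_zero ω, sub_self, add_zero]
  have hDito : IsItoProcess D β γ brownian brownianFiltration preWienerMeasure := by
    refine ⟨?_, fun t ω ↦ N2 t ω - N1 t ω, hJd, ae_of_all _ fun ω t ↦ ?_⟩
    · filter_upwards [hXint, hYint] with ω hxi hyi t
      rw [hβ]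
      exact integrableOn_trunc (g := fun s ω ↦ along b Y s ω - along b X s ω) ((hyi t).sub (hxi t))
    · rw [hD0 ω, zero_add]
      rfl
  -- the Yamada–Watanabe estimate
  have hcore := ae_eq_zero_of_yamadaWatanabe hρm hρpos hρint hDp hβp hγp hDito hD0
    (le_max_right Kb 0) hDbdd hβle hγsq hγρ' hγ0
  intro s hs
  filter_upwards [hcore s hs, hDeq] with ω h0 hde
  have := hde s
  rw [h0] at this
  linarith

/-! ### Pathwise uniqueness -/

/-- **Pathwise uniqueness, progressive case.** On the canonical space, two progressively measurable
solutions (raw Brownian filtration) of `dX = b(t,X) dt + σ(t,X) dB`, `X₀ = x₀`, under the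
Yamada–Watanabe hypotheses of Revuz–Yor IX (3.5)(ii) (`σ` locally bounded with
`(σ(s,x) - σ(s,y))² ≤ ρ(|x - y|)`, `∫_{0+} da/ρ(a) = ∞`, `b` Lipschitz on compacts locally
uniformly in time) are indistinguishable: localise at the optional times `ρ_k` (first rational
time at which `|X| ∨ |Y|` exceeds `|x₀| + k`, `IsStrongSolution.stopped_ae_eq_of_sq_sub_le`) and let
`k → ∞` along the a.s. continuous paths — as in `IsStrongSolution.unique_of_isStronglyProgressive`.
Revuz–Yor, *Continuous Martingales and Brownian Motion* (1999), Ch. IX, Thm (3.5)(ii).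
[cite: RevuzYor1999, Ch. IX Thm (3.5)(ii)] -/
theorem IsStrongSolution.unique_of_isStronglyProgressive_of_sq_sub_le
    {b σ : ℝ → ℝ → ℝ} {ρ : ℝ → ℝ} {x₀ : ℝ}
    (hbm : Measurable (Function.uncurry b)) (hσm : Measurable (Function.uncurry σ))
    (hρm : Measurable ρ) (hρpos : ∀ a, 0 < a → 0 < ρ a)
    (hρint : ∀ ε, 0 < ε → ¬ IntegrableOn (fun a ↦ (ρ a)⁻¹) (Set.Ioo 0 ε))
    (hσbd : ∀ t R : ℝ, ∃ C : ℝ, ∀ s ∈ Set.Icc 0 t, ∀ x ∈ Set.Icc (-R) R, |σ s x| ≤ C)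
    (hσρ : ∀ s x y, x ≠ y → (σ s x - σ s y) ^ 2 ≤ ρ |x - y|)
    (hbL : ∀ t R : ℝ, ∃ K : ℝ, ∀ s ∈ Set.Icc 0 t, ∀ x ∈ Set.Icc (-R) R, ∀ y ∈ Set.Icc (-R) R,
      |b s x - b s y| ≤ K * |x - y|)
    {X Y : ℝ≥0 → (ℝ≥0 → ℝ) → ℝ}
    (hXp : IsStronglyProgressive brownianFiltration X)
    (hYp : IsStronglyProgressive brownianFiltration Y)
    (hX : IsStrongSolution b σ x₀ X brownian brownianFiltration preWienerMeasure)
    (hY : IsStrongSolution b σ x₀ Y brownian brownianFiltration preWienerMeasure) :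
    ∀ᵐ ω ∂preWienerMeasure, ∀ t, X t ω = Y t ω := by
  have hXc := hX.ae_continuous
  have hYc := hY.ae_continuous
  have hXa : Adapted brownianFiltration X := hX.2.1
  have hYa : Adapted brownianFiltration Y := hY.2.1
  -- the level process `U = |X| ∨ |Y|` and the optional times `ρ k`
  have hUa : Adapted brownianFiltration (fun t ω ↦ max |X t ω| |Y t ω|) := fun t ↦
    (continuous_abs.measurable.comp (hXa t)).max (continuous_abs.measurable.comp (hYa t))
  have hUc : ∀ᵐ ω ∂preWienerMeasure, Continuous (fun t ↦ max |X t ω| |Y t ω|) := by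
    filter_upwards [hXc, hYc] with ω h1 h2
    exact (continuous_abs.comp h1).max (continuous_abs.comp h2)
  have hρopt : ∀ (k : ℕ) (t : ℝ≥0), MeasurableSet[brownianFiltration t]
      {ω | ratHitting (fun t ω ↦ max |X t ω| |Y t ω|) (|x₀| + k) ω < t} :=
    fun k t ↦ measurableSet_ratHitting_lt hUa t
  have hbound : ∀ k : ℕ, ∀ᵐ ω ∂preWienerMeasure, ∀ s : ℝ≥0,
      (s : WithTop ℝ≥0) ≤ ratHitting (fun t ω ↦ max |X t ω| |Y t ω|) (|x₀| + k) ω →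
        |X s ω| ≤ |x₀| + k ∧ |Y s ω| ≤ |x₀| + k := by
    intro k
    filter_upwards [hUc] with ω hu s hs
    have := le_of_le_ratHitting (U := fun t ω ↦ max |X t ω| |Y t ω|) hu
      (by simp only [hX.1 ω, hY.1 ω, max_self]; exact le_add_of_nonneg_right k.cast_nonneg) hs
    exact ⟨(le_max_left _ _).trans this, (le_max_right _ _).trans this⟩
  -- localised uniqueness at every rational time, for every `k`
  have hall : ∀ᵐ ω ∂preWienerMeasure, ∀ (k : ℕ) (q : ℚ),
      stoppedProcess Y (ratHitting (fun t ω ↦ max |X t ω| |Y t ω|) (|x₀| + k)) (q : ℝ).toNNReal ω =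
        stoppedProcess X (ratHitting (fun t ω ↦ max |X t ω| |Y t ω|) (|x₀| + k))
          (q : ℝ).toNNReal ω := by
    rw [ae_all_iff]; intro k
    rw [ae_all_iff]; intro q
    refine IsStrongSolution.stopped_ae_eq_of_sq_sub_le hbm hσm hρm hρpos hρint hσbd hσρ hbL hXp hYp
      hX hY (hρopt k) (hbound k) (⌈(q : ℝ)⌉₊ : ℝ≥0) _ ?_
    exact Real.toNNReal_le_iff_le_coe.2 (by rw [NNReal.coe_natCast]; exact Nat.le_ceil _)
  filter_upwards [hall, hXc, hYc, hUc] with ω h hx hy hu t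
  have hev : ∀ᶠ k : ℕ in atTop, (t : WithTop ℝ≥0) <
      ratHitting (fun t ω ↦ max |X t ω| |Y t ω|) (|x₀| + k) ω :=
    (tendsto_atTop_add_const_left atTop |x₀| tendsto_natCast_atTop_atTop).eventually
      (eventually_lt_ratHitting hu t)
  obtain ⟨k, hk⟩ := hev.exists
  -- the stopped difference is continuous and vanishes at the dense rational times
  have hcont : Continuous (fun s ↦
      stoppedProcess Y (ratHitting (fun t ω ↦ max |X t ω| |Y t ω|) (|x₀| + k)) s ω -
        stoppedProcess X (ratHitting (fun t ω ↦ max |X t ω| |Y t ω|) (|x₀| + k)) s ω) :=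
    (continuous_stoppedProcess_apply hy _).sub (continuous_stoppedProcess_apply hx _)
  have hzero : (fun s ↦
      stoppedProcess Y (ratHitting (fun t ω ↦ max |X t ω| |Y t ω|) (|x₀| + k)) s ω -
        stoppedProcess X (ratHitting (fun t ω ↦ max |X t ω| |Y t ω|) (|x₀| + k)) s ω) =
      fun _ ↦ (0 : ℝ) :=
    Continuous.ext_on denseRange_toNNReal_ratCast hcont continuous_const (by
      rintro _ ⟨q, rfl⟩
      simp only [h k q, sub_self])
  have := congrFun hzero t
  rw [stoppedProcess_eq_of_le hk.le, stoppedProcess_eq_of_le hk.le] at this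
  linarith

/-- **Pathwise uniqueness under the Yamada–Watanabe hypotheses** (RY IX Thm (3.5)(ii)) for
solutions adapted to the raw Brownian filtration of the canonical space: reduce to progressively
measurable solutions by left regularisation (`IsStrongSolution.dyadicReg_spec`), then
`IsStrongSolution.unique_of_isStronglyProgressive_of_sq_sub_le`.
Revuz–Yor, *Continuous Martingales and Brownian Motion* (1999), Ch. IX, Thm (3.5)(ii).
[cite: RevuzYor1999, Ch. IX Thm (3.5)(ii)] -/
theorem IsStrongSolution.unique_of_sq_sub_le
    {b σ : ℝ → ℝ → ℝ} {ρ : ℝ → ℝ} {x₀ : ℝ}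
    (hbm : Measurable (Function.uncurry b)) (hσm : Measurable (Function.uncurry σ))
    (hρm : Measurable ρ) (hρpos : ∀ a, 0 < a → 0 < ρ a)
    (hρint : ∀ ε, 0 < ε → ¬ IntegrableOn (fun a ↦ (ρ a)⁻¹) (Set.Ioo 0 ε))
    (hσbd : ∀ t R : ℝ, ∃ C : ℝ, ∀ s ∈ Set.Icc 0 t, ∀ x ∈ Set.Icc (-R) R, |σ s x| ≤ C)
    (hσρ : ∀ s x y, x ≠ y → (σ s x - σ s y) ^ 2 ≤ ρ |x - y|)
    (hbL : ∀ t R : ℝ, ∃ K : ℝ, ∀ s ∈ Set.Icc 0 t, ∀ x ∈ Set.Icc (-R) R, ∀ y ∈ Set.Icc (-R) R,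
      |b s x - b s y| ≤ K * |x - y|)
    {X Y : ℝ≥0 → (ℝ≥0 → ℝ) → ℝ}
    (hX : IsStrongSolution b σ x₀ X brownian brownianFiltration preWienerMeasure)
    (hY : IsStrongSolution b σ x₀ Y brownian brownianFiltration preWienerMeasure) :
    ∀ᵐ ω ∂preWienerMeasure, ∀ t, X t ω = Y t ω := by
  obtain ⟨hX', hX'p, hXe⟩ := hX.dyadicReg_spec
  obtain ⟨hY', hY'p, hYe⟩ := hY.dyadicReg_spec
  filter_upwards [IsStrongSolution.unique_of_isStronglyProgressive_of_sq_sub_le hbm hσm hρm hρpos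
    hρint hσbd hσρ hbL hX'p hY'p hX' hY', hXe, hYe] with ω h hx hy t
  rw [← hx t, ← hy t, h t]

/-- **Discharge of `pathwiseUnique_strongSolution_of_sq_sub_le`** (Yamada–Watanabe pathwise
uniqueness, Revuz–Yor Ch. IX Thm (3.5)(ii) with the standing assumptions of §3 and Cor. (3.4)):
for `b, σ` jointly Borel, `σ` locally bounded on `ℝ₊ × ℝ` with
`(σ(s,x) - σ(s,y))² ≤ ρ(|x - y|)` (`ρ > 0` Borel on `(0,∞)`, `∫_{0+} da/ρ(a) = +∞`) and `b`
Lipschitz in `x` on compacts locally uniformly in time, any two solutions of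
`dX = b(t,X) dt + σ(t,X) dB`, `X₀ = x₀`, driven by the canonical Brownian motion and adapted to its
raw natural filtration are indistinguishable. Proof in this file (Yamada–Watanabe's test-function
argument with the test function adapted to the expected occupation measure, localisation at
optional times of the raw filtration, Gronwall).
Revuz–Yor, *Continuous Martingales and Brownian Motion* (1999), Ch. IX, §3 (p. 348), Cor. (3.4),
Thm (3.5)(ii); Yamada–Watanabe, J. Math. Kyoto Univ. 11 (1971), Thm 1.
[cite: RevuzYor1999, Ch. IX Thm (3.5)(ii)] -/
theorem pathwiseUnique_strongSolution_of_sq_sub_le_holds :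
    pathwiseUnique_strongSolution_of_sq_sub_le :=
  fun _ _ _ _ _ _ hbm hσm hρm hρpos hρint hσbd hσρ hbL hX hX' ↦
    IsStrongSolution.unique_of_sq_sub_le hbm hσm hρm hρpos hρint hσbd hσρ hbL hX hX'

end Literature.Analysis.FunctionSpaces
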